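import Literature.NumberTheory.Automorphic.SchwartzBruhatL2Dense
import Mathlib.MeasureTheory.Integral.Bochner.Basic
import Mathlib.MeasureTheory.Function.L1Space.Integrable
import HarnessLib

/-!
# The `L²` pairing `⟨Φ, Ψ⟩ = ∫ Φ Ψ̄ dν` on Schwartz–Bruhat functions: polarization, and invariance under `L²`-isometric maps

Topic `NumberTheory/Automorphic`; namespace `Literature.NumberTheory.Automorphic.SchwartzBruhat` (continuing `SchwartzBruhatL2Norm`,
`SchwartzBruhatL2Dense`).
KERNEL only: theorems, no definition, no named fact, no `sorry`.

[Weil1964, Chap. I n° 11–13] works with the unitary structure of `L²(X)` restricted to the Schwartz–Bruhat functions `𝒮(X)` (locally constant,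
compactly supported): the operators of the metaplectic group are `L²`-isometries, hence preserve the inner product.  The tree records isometry
as preservation of the SQUARE NORM `l2NormSq ν Φ = ∫⁻ ‖Φ‖ₑ²` (`Representation.IsL2Isometric`, `SchwartzBruhatL2Norm`); consumers that pair two
DIFFERENT vectors (matrix coefficients `⟨ω(h)Φ, Ψ⟩ = ∫ (ω(h)Φ) Ψ̄ dν` — [Li1992, Thm 2.1 (26)–(27)]) need the consequence for the sesquilinear
PAIRING.  This file proves it (polarization):

* §1 `integrable_mul_conj`, `integral_mul_conj_self_eq_toReal_l2NormSq` — `Φ Ψ̄` is integrable for `Φ, Ψ ∈ 𝒮(X)` and a measure finite on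
  compact sets; `∫ Φ Φ̄ dν = ‖Φ‖²_{L²(ν)}` (the `ℝ≥0∞` square norm of `SchwartzBruhatL2Norm`, as a complex number);
* §2 `four_mul_integral_mul_conj` — POLARIZATION: `4 ∫ Φ Ψ̄ = Q(Φ+Ψ) − Q(Φ−Ψ) + i Q(Φ+iΨ) − i Q(Φ−iΨ)`, `Q(Θ) = ∫ Θ Θ̄`
  (from the pointwise identity `4 a b̄ = |a+b|² − |a−b|² + i|a+ib|² − i|a−ib|²`);
* §3 **`integral_mul_conj_map_eq_of_l2NormSq_eq`** — a `ℂ`-linear map `A : 𝒮(X) → 𝒮(X)` preserving `l2NormSq ν` preserves the pairing: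
  `∫ (AΦ) (AΨ)‾ dν = ∫ Φ Ψ̄ dν`; **`Representation.IsL2Isometric.integral_mul_conj_apply`** — the same for every operator of an
  `L²`-isometric representation.

Written for the split-place local factors of the cell `hodgecm-mathlib` (FLOOR 0, P4 (F4): the spherical matrix coefficients
`⟨ω_v(z₀^m·1) 1_{𝒪ᴺ}, 1_{𝒪ᴺ}⟩` are read through an isometric implementer); nothing here is specific to that consumer.

## References
* [Weil1964] A. Weil, *Sur certains groupes d'opérateurs unitaires*, Acta Math. 111 (1964), Chap. I n° 11–13.
* [Li1992] J.-S. Li, J. reine angew. Math. 428 (1992), Thm 2.1 (26)–(27) p. 184 (the pairing `⟨ω(h)φ₁, φ₂⟩` on `S(X(A))`).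
-/

set_option autoImplicit false

noncomputable section

open MeasureTheory
open scoped ENNReal ComplexConjugate

namespace Literature.NumberTheory.Automorphic

namespace SchwartzBruhat

variable {X : Type*} [TopologicalSpace X] [MeasurableSpace X] [OpensMeasurableSpace X] (ν : Measure X)
  [IsFiniteMeasureOnCompacts ν]

/-! ## §1 Integrability; `∫ Φ Φ̄ = ‖Φ‖²` -/

/-- **`Φ Ψ̄` is integrable** for `Φ, Ψ ∈ 𝒮(X)` and `ν` finite on compact sets (continuous with compact support).
[cite: Weil1964, Chap. I n° 11] -/
theorem integrable_mul_conj (Φ Ψ : SchwartzBruhat X) :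
    Integrable (fun x => ((Φ : SchwartzBruhat X) : X → ℂ) x * conj (((Ψ : SchwartzBruhat X) : X → ℂ) x)) ν :=
  ((continuous_coe Φ).mul (Complex.continuous_conj.comp (continuous_coe Ψ))).integrable_of_hasCompactSupport
    (Φ.2.2.mul_right)

omit [IsFiniteMeasureOnCompacts ν] in
/-- **`∫ Φ Φ̄ dν = ‖Φ‖²_{L²(ν)}`**: the self-pairing is the square norm `l2NormSq ν Φ` of `SchwartzBruhatL2Norm`, as a complex number (both
sides read `0` when infinite). [cite: Weil1964, Chap. I n° 11] -/
theorem integral_mul_conj_self_eq_toReal_l2NormSq (Φ : SchwartzBruhat X) :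
    ∫ x, ((Φ : SchwartzBruhat X) : X → ℂ) x * conj (((Φ : SchwartzBruhat X) : X → ℂ) x) ∂ν = ((l2NormSq ν Φ).toReal : ℂ) := by
  have h1 : ∫ x, ((Φ : SchwartzBruhat X) : X → ℂ) x * conj (((Φ : SchwartzBruhat X) : X → ℂ) x) ∂ν =
      ((∫ x, ‖((Φ : SchwartzBruhat X) : X → ℂ) x‖ ^ 2 ∂ν : ℝ) : ℂ) := by
    rw [← integral_complex_ofReal]
    refine integral_congr_ae (Filter.Eventually.of_forall fun x => ?_)
    dsimp only
    rw [Complex.mul_conj', Complex.ofReal_pow]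
  rw [h1, integral_eq_lintegral_of_nonneg_ae (Filter.Eventually.of_forall fun x => sq_nonneg _)
    (((continuous_coe Φ).norm.pow 2).aestronglyMeasurable), l2NormSq_def]
  congr 2
  refine lintegral_congr fun x => ?_
  rw [← ofReal_norm, ENNReal.ofReal_pow (norm_nonneg _)]

/-! ## §2 Polarization -/

omit [OpensMeasurableSpace X] [IsFiniteMeasureOnCompacts ν] in
/-- pointwise polarization: `4 a b̄ = |a+b|² − |a−b|² + i |a+ib|² − i |a−ib|²`. [folklore] -/
private theorem four_mul_mul_conj (a b : ℂ) :
    4 * (a * conj b) = (a + b) * conj (a + b) - (a - b) * conj (a - b) +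
      Complex.I * ((a + Complex.I * b) * conj (a + Complex.I * b)) -
        Complex.I * ((a - Complex.I * b) * conj (a - Complex.I * b)) := by
  simp only [map_add, map_sub, map_mul, Complex.conj_I]
  ring_nf
  rw [Complex.I_sq]
  ring

/-- **POLARIZATION for the pairing `∫ Φ Ψ̄`**: `4 ∫ Φ Ψ̄ = Q(Φ+Ψ) − Q(Φ−Ψ) + i Q(Φ+iΨ) − i Q(Φ−iΨ)` with `Q(Θ) = ∫ Θ Θ̄`.
[cite: Weil1964, Chap. I n° 11] -/
theorem four_mul_integral_mul_conj (Φ Ψ : SchwartzBruhat X) :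
    4 * ∫ x, ((Φ : SchwartzBruhat X) : X → ℂ) x * conj (((Ψ : SchwartzBruhat X) : X → ℂ) x) ∂ν =
      (∫ x, ((Φ + Ψ : SchwartzBruhat X) : X → ℂ) x * conj (((Φ + Ψ : SchwartzBruhat X) : X → ℂ) x) ∂ν) -
        (∫ x, ((Φ - Ψ : SchwartzBruhat X) : X → ℂ) x * conj (((Φ - Ψ : SchwartzBruhat X) : X → ℂ) x) ∂ν) +
        Complex.I * (∫ x, ((Φ + Complex.I • Ψ : SchwartzBruhat X) : X → ℂ) x *
          conj (((Φ + Complex.I • Ψ : SchwartzBruhat X) : X → ℂ) x) ∂ν) -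
        Complex.I * (∫ x, ((Φ - Complex.I • Ψ : SchwartzBruhat X) : X → ℂ) x *
          conj (((Φ - Complex.I • Ψ : SchwartzBruhat X) : X → ℂ) x) ∂ν) := by
  have hI1 := integrable_mul_conj ν (Φ + Ψ) (Φ + Ψ)
  have hI2 := integrable_mul_conj ν (Φ - Ψ) (Φ - Ψ)
  have hI3 := integrable_mul_conj ν (Φ + Complex.I • Ψ) (Φ + Complex.I • Ψ)
  have hI4 := integrable_mul_conj ν (Φ - Complex.I • Ψ) (Φ - Complex.I • Ψ)
  calc 4 * ∫ x, ((Φ : SchwartzBruhat X) : X → ℂ) x * conj (((Ψ : SchwartzBruhat X) : X → ℂ) x) ∂ν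
      = ∫ x, 4 * (((Φ : SchwartzBruhat X) : X → ℂ) x * conj (((Ψ : SchwartzBruhat X) : X → ℂ) x)) ∂ν :=
        (integral_const_mul _ _).symm
    _ = ∫ x, ((((Φ + Ψ : SchwartzBruhat X) : X → ℂ) x * conj (((Φ + Ψ : SchwartzBruhat X) : X → ℂ) x) -
            ((Φ - Ψ : SchwartzBruhat X) : X → ℂ) x * conj (((Φ - Ψ : SchwartzBruhat X) : X → ℂ) x)) +
            Complex.I * (((Φ + Complex.I • Ψ : SchwartzBruhat X) : X → ℂ) x *
              conj (((Φ + Complex.I • Ψ : SchwartzBruhat X) : X → ℂ) x))) -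
          Complex.I * (((Φ - Complex.I • Ψ : SchwartzBruhat X) : X → ℂ) x *
            conj (((Φ - Complex.I • Ψ : SchwartzBruhat X) : X → ℂ) x)) ∂ν := by
        refine integral_congr_ae (Filter.Eventually.of_forall fun x => ?_)
        simp only [Submodule.coe_add, Submodule.coe_sub, Submodule.coe_smul, Pi.add_apply, Pi.sub_apply, Pi.smul_apply,
          smul_eq_mul]
        exact four_mul_mul_conj _ _
    _ = _ := by
        have h12 : Integrable (fun x => ((Φ + Ψ : SchwartzBruhat X) : X → ℂ) x * conj (((Φ + Ψ : SchwartzBruhat X) : X → ℂ) x) -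
            ((Φ - Ψ : SchwartzBruhat X) : X → ℂ) x * conj (((Φ - Ψ : SchwartzBruhat X) : X → ℂ) x)) ν := hI1.sub hI2
        have h3 : Integrable (fun x => Complex.I * (((Φ + Complex.I • Ψ : SchwartzBruhat X) : X → ℂ) x *
            conj (((Φ + Complex.I • Ψ : SchwartzBruhat X) : X → ℂ) x))) ν := hI3.const_mul _
        have h4 : Integrable (fun x => Complex.I * (((Φ - Complex.I • Ψ : SchwartzBruhat X) : X → ℂ) x *
            conj (((Φ - Complex.I • Ψ : SchwartzBruhat X) : X → ℂ) x))) ν := hI4.const_mul _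
        have h123 : Integrable (fun x => (((Φ + Ψ : SchwartzBruhat X) : X → ℂ) x * conj (((Φ + Ψ : SchwartzBruhat X) : X → ℂ) x) -
            ((Φ - Ψ : SchwartzBruhat X) : X → ℂ) x * conj (((Φ - Ψ : SchwartzBruhat X) : X → ℂ) x)) +
            Complex.I * (((Φ + Complex.I • Ψ : SchwartzBruhat X) : X → ℂ) x *
              conj (((Φ + Complex.I • Ψ : SchwartzBruhat X) : X → ℂ) x))) ν := h12.add h3
        rw [integral_sub h123 h4, integral_add h12 h3, integral_sub hI1 hI2, integral_const_mul, integral_const_mul]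

/-! ## §3 `L²`-isometric maps preserve the pairing -/

/-- **An `l2NormSq`-preserving `ℂ`-linear map of `𝒮(X)` preserves the pairing `∫ Φ Ψ̄ dν`** (polarization).
[cite: Weil1964, Chap. I n° 11–13] -/
theorem integral_mul_conj_map_eq_of_l2NormSq_eq (A : SchwartzBruhat X →ₗ[ℂ] SchwartzBruhat X)
    (hA : ∀ Φ : SchwartzBruhat X, l2NormSq ν (A Φ) = l2NormSq ν Φ) (Φ Ψ : SchwartzBruhat X) :
    ∫ x, ((A Φ : SchwartzBruhat X) : X → ℂ) x * conj (((A Ψ : SchwartzBruhat X) : X → ℂ) x) ∂ν =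
      ∫ x, ((Φ : SchwartzBruhat X) : X → ℂ) x * conj (((Ψ : SchwartzBruhat X) : X → ℂ) x) ∂ν := by
  have h4 : (4 : ℂ) ≠ 0 := by norm_num
  apply mul_left_cancel₀ h4
  rw [four_mul_integral_mul_conj ν (A Φ) (A Ψ), four_mul_integral_mul_conj ν Φ Ψ, ← map_smul, ← map_add, ← map_sub, ← map_add,
    ← map_sub, integral_mul_conj_self_eq_toReal_l2NormSq, integral_mul_conj_self_eq_toReal_l2NormSq,
    integral_mul_conj_self_eq_toReal_l2NormSq, integral_mul_conj_self_eq_toReal_l2NormSq,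
    integral_mul_conj_self_eq_toReal_l2NormSq, integral_mul_conj_self_eq_toReal_l2NormSq,
    integral_mul_conj_self_eq_toReal_l2NormSq, integral_mul_conj_self_eq_toReal_l2NormSq, hA, hA, hA, hA]

/-- the same for a linear EQUIVALENCE (e.g. an implementer of the Schrödinger model). [cite: Weil1964, Chap. I n° 13] -/
theorem integral_mul_conj_equiv_eq_of_l2NormSq_eq (A : SchwartzBruhat X ≃ₗ[ℂ] SchwartzBruhat X)
    (hA : ∀ Φ : SchwartzBruhat X, l2NormSq ν (A Φ) = l2NormSq ν Φ) (Φ Ψ : SchwartzBruhat X) :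
    ∫ x, ((A Φ : SchwartzBruhat X) : X → ℂ) x * conj (((A Ψ : SchwartzBruhat X) : X → ℂ) x) ∂ν =
      ∫ x, ((Φ : SchwartzBruhat X) : X → ℂ) x * conj (((Ψ : SchwartzBruhat X) : X → ℂ) x) ∂ν :=
  integral_mul_conj_map_eq_of_l2NormSq_eq ν A.toLinearMap hA Φ Ψ

/-- … and for its INVERSE. [cite: Weil1964, Chap. I n° 13] -/
theorem integral_mul_conj_symm_eq_of_l2NormSq_eq (A : SchwartzBruhat X ≃ₗ[ℂ] SchwartzBruhat X)
    (hA : ∀ Φ : SchwartzBruhat X, l2NormSq ν (A Φ) = l2NormSq ν Φ) (Φ Ψ : SchwartzBruhat X) :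
    ∫ x, ((A.symm Φ : SchwartzBruhat X) : X → ℂ) x * conj (((A.symm Ψ : SchwartzBruhat X) : X → ℂ) x) ∂ν =
      ∫ x, ((Φ : SchwartzBruhat X) : X → ℂ) x * conj (((Ψ : SchwartzBruhat X) : X → ℂ) x) ∂ν := by
  have h := integral_mul_conj_equiv_eq_of_l2NormSq_eq ν A hA (A.symm Φ) (A.symm Ψ)
  rw [A.apply_symm_apply, A.apply_symm_apply] at h
  exact h.symm

end SchwartzBruhat

/-- **Every operator of an `L²`-isometric representation on `𝒮(X)` preserves the pairing `∫ Φ Ψ̄ dν`.**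
[cite: Weil1964, Chap. I n° 11–13] -/
theorem _root_.Representation.IsL2Isometric.integral_mul_conj_apply {X : Type*} [TopologicalSpace X] [MeasurableSpace X]
    [OpensMeasurableSpace X] {ν : Measure X} [IsFiniteMeasureOnCompacts ν] {G : Type*} [Monoid G]
    {ρ : Representation ℂ G (SchwartzBruhat X)} (h : ρ.IsL2Isometric ν) (g : G) (Φ Ψ : SchwartzBruhat X) :
    ∫ x, ((ρ g Φ : SchwartzBruhat X) : X → ℂ) x * conj (((ρ g Ψ : SchwartzBruhat X) : X → ℂ) x) ∂ν =
      ∫ x, ((Φ : SchwartzBruhat X) : X → ℂ) x * conj (((Ψ : SchwartzBruhat X) : X → ℂ) x) ∂ν :=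
  SchwartzBruhat.integral_mul_conj_map_eq_of_l2NormSq_eq ν (ρ g) (fun Θ => h.l2NormSq_apply g Θ) Φ Ψ

end Literature.NumberTheory.Automorphic

end
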